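import Literature.NumberTheory.EllipticCurves.TwoIsogenyShaTwoTorsion
import Literature.NumberTheory.EllipticCurves.ShaCorankBaseChange
import Literature.NumberTheory.EllipticCurves.IsogenyVariableChangeProofs
import Literature.NumberTheory.EllipticCurves.SelmerCorankIsogenyProofs
import HarnessLib

/-!
# The `2`-isogeny descent door over a number field: `Ш(V₀/K)[φ] = 0 ∧ Ш(X/K)[φ] = 0 ⇒ t₂(E/ℚ) = 0` whenever `E ⊗ K ≅ X`

Topic `NumberTheory/EllipticCurves`. Generic packaging of the route by which the tree proved `t₂(E_{28/9}) = 0`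
(`KubertTate289ShaTwo`): an elliptic curve `E/ℚ` WITHOUT a rational `2`-torsion point acquires one over a number field
`K` (e.g. its cubic `2`-division field); there `E ⊗ K ≅ X = E_{A,B} : y² = x³ + Ax² + Bx` by a change of variables, and a
complete `2`-isogeny descent `X ⇄ X'` over `K` — both `Ш(V₀/K) ∩ im Ξ_{V₀} = ⊥` for the half-model
`V₀ = ⟨0, -A/2, 0, (A² - 4B)/16, 0⟩` of `X'` (so that `V₀' = X` literally) and `Ш(X/K) ∩ im Ξ_X = ⊥` — gives
`Ш(X/K)[2] = 0` (Silverman *AEC* X.4.2 with III.6.1–6.2, tree `eq_zero_of_mem_sha_twoIsogenyCodomain_of_two_smul_eq_zero`),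
hence `t₂(X/K) = 0`, `t₂(E ⊗ K) = 0` (the corank of `Ш[2^∞]` is an isogeny invariant) and `t₂(E/ℚ) = 0`
(`t_p(E/ℚ) ≤ t_p(E ⊗ K/K)`: the restriction `Ш(E/ℚ) → Ш(E_K/K)` has finite kernel, Darmon 2004 Exercise 3.18; tree
`ShaCorankBaseChange`). Over a general field of characteristic `0`:

* `twoIsogenyCodomain_halfModel'` — `V₀' = X` for the half-model; `isElliptic_halfModel'` — `V₀` is elliptic iff `X` is;
* `forall_mem_sha_two_smul_eq_zero_of_halfModel'` — **`Ш(X/K)[2] = 0`** from the two `Ξ`-hypotheses (number field `K`);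
* `shaCorank_two_eq_zero_of_halfModel` — `t₂(X/K) = 0`;
* `shaCorank_two_baseChange_eq_zero_of_descent` — `t₂(E ⊗ K) = 0` for any `E/F` with `v • (E ⊗ K) = X`;
* `shaCorank_two_eq_zero_of_descent_baseChange` — **`t₂(E/F) = 0`** (the door downstairs), `F ⊆ K` number fields.

Theorems only; no named facts. BSD is not touched.

## References
* [SilvermanAEC2009] J. H. Silverman, *The Arithmetic of Elliptic Curves*, 2nd ed. (2009), Thm. X.4.2, Prop. X.4.9, III.3.1(b).
* [Darmon2004] H. Darmon, *Rational Points on Modular Elliptic Curves*, CBMS 101 (2004), §3.9, Exercise 3.18.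
* [Greenberg1999LNM] R. Greenberg, *Iwasawa theory for elliptic curves*, LNM 1716 (1999), §1 (pp. 54–57).
-/

noncomputable section

open scoped Classical

namespace WeierstrassCurve

open Affine

section Field

variable {K : Type*} [Field K] [CharZero K]

/-- **`V₀' = X`**: the `2`-isogenous curve of the half-model `V₀ = ⟨0, -A/2, 0, (A² - 4B)/16, 0⟩` is
`X = ⟨0, A, 0, B, 0⟩` literally (`V₀ ≅ X'` by `u = 2`). [cite: SilvermanAEC2009, Prop. X.4.9] -/
theorem twoIsogenyCodomain_halfModel' (A B : K) :
    (⟨0, -A / 2, 0, (A ^ 2 - 4 * B) / 16, 0⟩ : WeierstrassCurve K).twoIsogenyCodomain = ⟨0, A, 0, B, 0⟩ := by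
  ext
  · simp [twoIsogenyCodomain]
  · simp only [twoIsogenyCodomain]; ring
  · simp [twoIsogenyCodomain]
  · simp only [twoIsogenyCodomain]; ring
  · simp [twoIsogenyCodomain]

/-- `X = E_{A,B}` is elliptic iff `B(A² - 4B) ≠ 0` (`Δ = 16B²(A² - 4B)`). [cite: SilvermanAEC2009, Prop. X.4.9] -/
theorem isElliptic_twoTorsionNF_iff (A B : K) :
    (⟨0, A, 0, B, 0⟩ : WeierstrassCurve K).IsElliptic ↔ B * (A ^ 2 - 4 * B) ≠ 0 := by
  constructor
  · intro h
    have hΔ := h.isUnit.ne_zero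
    rw [Δ_of_isTwoTorsionNF] at hΔ
    intro h0
    apply hΔ
    rcases mul_eq_zero.mp h0 with hB | hD
    · simp [hB]
    · simp only at hD ⊢; rw [hD, mul_zero]
  · intro h
    refine ⟨isUnit_iff_ne_zero.mpr ?_⟩
    rw [Δ_of_isTwoTorsionNF]
    simp only
    obtain ⟨hB, hD⟩ := mul_ne_zero_iff.mp h
    exact mul_ne_zero (mul_ne_zero (by norm_num) (pow_ne_zero 2 hB)) hD

/-- **The half-model `V₀` is elliptic iff `X` is** (`Δ(V₀) = B'²B/16`, `Δ(X) = 16B²B'`, `B' = A² - 4B`).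
[cite: SilvermanAEC2009, Prop. X.4.9] -/
theorem isElliptic_halfModel' {A B : K} (h : (⟨0, A, 0, B, 0⟩ : WeierstrassCurve K).IsElliptic) :
    (⟨0, -A / 2, 0, (A ^ 2 - 4 * B) / 16, 0⟩ : WeierstrassCurve K).IsElliptic := by
  rw [isElliptic_twoTorsionNF_iff] at h ⊢
  obtain ⟨hB, hD⟩ := mul_ne_zero_iff.mp h
  have e : (-A / 2) ^ 2 - 4 * ((A ^ 2 - 4 * B) / 16) = B := by ring
  rw [e]
  exact mul_ne_zero (div_ne_zero hD (by norm_num)) hB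

end Field

section NumberField

variable {K : Type*} [Field K] [NumberField K]

/-- Transport of `Ш ∩ im Ξ = ⊥` along an equality of curves (the instances are propositions).
[cite: SilvermanAEC2009, Thm. X.4.2(a)] -/
private theorem sha_inf_range_transfer {W₁ W₂ : WeierstrassCurve K} (h : W₁ = W₂) [W₁.IsTwoTorsionNF] [W₁.IsElliptic]
    [W₂.IsTwoTorsionNF] [W₂.IsElliptic]
    (h₂ : W₂.sha ⊓ AddMonoidHom.range (G := Additive (SqUnits K)) W₂.twoIsogenyTorsorHom = ⊥) :
    W₁.sha ⊓ AddMonoidHom.range (G := Additive (SqUnits K)) W₁.twoIsogenyTorsorHom = ⊥ := by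
  subst h
  exact h₂

/-- Transport of "`Ш` has no `2`-torsion" along an equality of curves. [cite: SilvermanAEC2009, Thm. X.4.2(a)] -/
private theorem sha_two_transfer {W₁ W₂ : WeierstrassCurve K} (h : W₁ = W₂)
    (h₁ : ∀ c ∈ W₁.sha, 2 • c = 0 → c = 0) : ∀ c ∈ W₂.sha, 2 • c = 0 → c = 0 := by
  subst h
  exact h₁

/-- **`Ш(V₀)[φ] = 0 ∧ Ш(X)[φ] = 0 ⇒ Ш(X/K)[2] = 0` over a number field**, for `X = ⟨0, A, 0, B, 0⟩` and its half-model
`V₀ = ⟨0, -A/2, 0, (A² - 4B)/16, 0⟩` (`V₀' = X`): the number-field form of `forall_mem_sha_two_smul_eq_zero_of_halfModel`.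
[cite: SilvermanAEC2009, Thm. X.4.2(a)] -/
theorem forall_mem_sha_two_smul_eq_zero_of_halfModel' {A B : K}
    [hX : (⟨0, A, 0, B, 0⟩ : WeierstrassCurve K).IsElliptic]
    (h₀ : haveI := isElliptic_halfModel' hX
      (⟨0, -A / 2, 0, (A ^ 2 - 4 * B) / 16, 0⟩ : WeierstrassCurve K).sha ⊓
        AddMonoidHom.range (G := Additive (SqUnits K))
          (⟨0, -A / 2, 0, (A ^ 2 - 4 * B) / 16, 0⟩ : WeierstrassCurve K).twoIsogenyTorsorHom = ⊥)
    (h₁ : (⟨0, A, 0, B, 0⟩ : WeierstrassCurve K).sha ⊓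
      AddMonoidHom.range (G := Additive (SqUnits K)) (⟨0, A, 0, B, 0⟩ : WeierstrassCurve K).twoIsogenyTorsorHom = ⊥) :
    ∀ c ∈ (⟨0, A, 0, B, 0⟩ : WeierstrassCurve K).sha, 2 • c = 0 → c = 0 := by
  haveI := isElliptic_halfModel' hX
  have hE' := twoIsogenyCodomain_halfModel' A B
  exact sha_two_transfer hE' fun c hc h2 ↦
    eq_zero_of_mem_sha_twoIsogenyCodomain_of_two_smul_eq_zero _ h₀ (sha_inf_range_transfer hE' h₁) hc h2

/-- **`t₂(X/K) = corank_{ℤ₂} Ш(X/K)[2^∞] = 0`** from the two `Ξ`-hypotheses. [cite: SilvermanAEC2009, Thm. X.4.2(a)]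
[cite: Greenberg1999LNM, §1 (pp. 54–57)] -/
theorem shaCorank_two_eq_zero_of_halfModel {A B : K}
    [hX : (⟨0, A, 0, B, 0⟩ : WeierstrassCurve K).IsElliptic]
    (h₀ : haveI := isElliptic_halfModel' hX
      (⟨0, -A / 2, 0, (A ^ 2 - 4 * B) / 16, 0⟩ : WeierstrassCurve K).sha ⊓
        AddMonoidHom.range (G := Additive (SqUnits K))
          (⟨0, -A / 2, 0, (A ^ 2 - 4 * B) / 16, 0⟩ : WeierstrassCurve K).twoIsogenyTorsorHom = ⊥)
    (h₁ : (⟨0, A, 0, B, 0⟩ : WeierstrassCurve K).sha ⊓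
      AddMonoidHom.range (G := Additive (SqUnits K)) (⟨0, A, 0, B, 0⟩ : WeierstrassCurve K).twoIsogenyTorsorHom = ⊥) :
    (⟨0, A, 0, B, 0⟩ : WeierstrassCurve K).shaCorank 2 = 0 :=
  shaCorank_eq_zero_of_forall _ 2 (forall_mem_sha_two_smul_eq_zero_of_halfModel' h₀ h₁)

/-- **`t₂(E ⊗ K) = 0`** for any curve `E/F` whose base change is `K`-isomorphic to `X` (`v • (E ⊗ K) = X`), from the
descent on `X` (isogeny invariance of the corank). [cite: SilvermanAEC2009, III.3.1(b)] [cite: Greenberg1999LNM, §1 (pp. 54–57)] -/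
theorem shaCorank_two_baseChange_eq_zero_of_descent {F : Type*} [Field F] [Algebra F K] (E : WeierstrassCurve F)
    [E.IsElliptic] {A B : K} [hX : (⟨0, A, 0, B, 0⟩ : WeierstrassCurve K).IsElliptic] (v : VariableChange K)
    (hv : v • E.baseChange K = ⟨0, A, 0, B, 0⟩)
    (h₀ : haveI := isElliptic_halfModel' hX
      (⟨0, -A / 2, 0, (A ^ 2 - 4 * B) / 16, 0⟩ : WeierstrassCurve K).sha ⊓
        AddMonoidHom.range (G := Additive (SqUnits K))
          (⟨0, -A / 2, 0, (A ^ 2 - 4 * B) / 16, 0⟩ : WeierstrassCurve K).twoIsogenyTorsorHom = ⊥)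
    (h₁ : (⟨0, A, 0, B, 0⟩ : WeierstrassCurve K).sha ⊓
      AddMonoidHom.range (G := Additive (SqUnits K)) (⟨0, A, 0, B, 0⟩ : WeierstrassCurve K).twoIsogenyTorsorHom = ⊥) :
    (E.baseChange K).shaCorank 2 = 0 := by
  haveI : (E.baseChange K).IsElliptic := by rw [WeierstrassCurve.baseChange]; infer_instance
  rw [(isIsogenous_of_smul_eq hv).shaCorank_eq 2]
  exact shaCorank_two_eq_zero_of_halfModel h₀ h₁

end NumberField

/-- **THE DOOR DOWNSTAIRS: `t₂(E/F) = 0`** for an elliptic curve `E` over a number field `F` which, over a finite extension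
`K/F`, becomes isomorphic to `X = E_{A,B}` (`v • (E ⊗ K) = X`) with a complete `2`-isogeny descent over `K`
(`Ш(V₀/K) ∩ im Ξ = ⊥` and `Ш(X/K) ∩ im Ξ = ⊥`): `t₂(E ⊗ K) = 0` and `t_p(E/F) ≤ t_p(E ⊗ K/K)`. The route of the tree's
`t₂(E_{28/9}) = 0` (cubic `2`-division field). [cite: SilvermanAEC2009, Thm. X.4.2(a)] [cite: Darmon2004, §3.9 and Exercise 3.18] -/
theorem shaCorank_two_eq_zero_of_descent_baseChange {F : Type} [Field F] [NumberField F] (E : WeierstrassCurve F)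
    [E.IsElliptic] (K : Type) [Field K] [NumberField K] [Algebra F K] {A B : K}
    [hX : (⟨0, A, 0, B, 0⟩ : WeierstrassCurve K).IsElliptic] (v : VariableChange K) (hv : v • E.baseChange K = ⟨0, A, 0, B, 0⟩)
    (h₀ : haveI := isElliptic_halfModel' hX
      (⟨0, -A / 2, 0, (A ^ 2 - 4 * B) / 16, 0⟩ : WeierstrassCurve K).sha ⊓
        AddMonoidHom.range (G := Additive (SqUnits K))
          (⟨0, -A / 2, 0, (A ^ 2 - 4 * B) / 16, 0⟩ : WeierstrassCurve K).twoIsogenyTorsorHom = ⊥)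
    (h₁ : (⟨0, A, 0, B, 0⟩ : WeierstrassCurve K).sha ⊓
      AddMonoidHom.range (G := Additive (SqUnits K)) (⟨0, A, 0, B, 0⟩ : WeierstrassCurve K).twoIsogenyTorsorHom = ⊥) :
    E.shaCorank 2 = 0 :=
  shaCorank_eq_zero_of_shaCorank_baseChange_eq_zero E K 2 (shaCorank_two_baseChange_eq_zero_of_descent E v hv h₀ h₁)

end WeierstrassCurve

end
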